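import Literature.NumberTheory.EllipticCurves.BSDSelmerCMPConverseProofs
import Literature.NumberTheory.EllipticCurves.ComplexMultiplicationShaRubinRationalCMProofs
import HarnessLib

/-!
# Burungale–Tian 2026, Theorem 1.1 AS PRINTED: the rank-zero `p`-converse for a CM elliptic curve over its CM field

A. A. Burungale, Y. Tian, *A rank zero `p`-converse to a theorem of Gross–Zagier, Kolyvagin and
Rubin*, Ann. of Math. (2) 203 (2026), no. 1, 1–13 (doi:10.4007/annals.2026.203.1.1) =
arXiv:2506.03465v2, **Theorem 1.1** (p. 1), verbatim:

> "Let `E` be an elliptic curve defined over an imaginary quadratic field `K`, with complex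
> multiplication by an order of `K`. Let `p` be a prime. Then
> `corank_{ℤ_p} Sel_{p^∞}(E/K) = 0 ⟹ ord_{s=1} L(s, E/K) = 0`.
> In particular, if `E` descends to `ℚ`, then (1.1) holds."

The tree's named fact
`Literature.NumberTheory.EllipticCurves.burungaleTian_analyticRank_eq_zero_of_selmerCorank_eq_zero_of_hasCM`
(`BSDSelmerCMPConverse.lean`) vendors only the LAST clause (the `E/ℚ` form (1.1) with `r = 0`);
its proofs companion `BSDSelmerCMPConverseProofs.lean` records "TODO(general form): Thm. 1.1 for any
`E/K` with CM by an order of `K` (`HasRationalCM` over `K`)". This file supplies that general form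
as ONE named fact, in the tree's existing vocabulary, and PROVES that it implies the clause already
vendored (so the new fact is threaded to every consumer of the old one):

* `burungaleTian_analyticRank_eq_zero_of_selmerCorank_eq_zero_of_hasRationalCM` (**named fact**,
  Thm. 1.1 as printed): for `K` imaginary quadratic (`IsImaginaryQuadratic K`, `HeegnerPoints.lean`),
  `V : WeierstrassCurve K` elliptic with `K`-rational complex multiplication
  (`WeierstrassCurve.HasRationalCM`, `Isogeny.lean`) and any prime `p`:
  `V.selmerCorank p = 0 → V.analyticRank = 0`.
* `cmField_form_of_hasRationalCM` (**proved**): the fact implies the hypothesis `hBT` of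
  `burungaleTian_analyticRank_eq_zero_of_selmerCorank_eq_zero_of_hasCM_of_cmField` (Thm. 1.1
  for the base changes `W_K` of the nine curves `W/ℚ` with `j(W) ∈ maximalCMJInvariants` to their
  CM field `K`, `IsCMFieldOfJ K j(W)`), because such a `K` is imaginary quadratic
  (`IsCMFieldOfJ.isTotallyComplex`) and `W_K` has `K`-rational CM
  (`Rubin1987.hasRationalCM_baseChange_of_isCMFieldOfJ`, Silverman *Advanced Topics* II.2.2(b)).
* `burungaleTian_analyticRank_eq_zero_of_selmerCorank_eq_zero_of_hasCM_of_hasRationalCM`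
  (**proved**): the fact + modularity over `ℚ` (`WeierstrassCurve.hasEntireLFunction_rat`, only to
  read `ord_{s=1} L(s, E/K) = 2 ord_{s=1} L(E, s)`) ⟹ the vendored `E/ℚ` fact — the printed
  "In particular, if `E` descends to `ℚ`" (proof on arXiv p. 6: `corank Sel(E/K) = 2 corank Sel(E/ℚ)`,
  `ord L(E/K) = 2 ord L(E/ℚ)`, both tree theorems of `BSDSelmerCMPConverseProofs`);
  `…_of_hasRationalCM_of_deuringHecke`: the same below the Deuring–Hecke continuation
  (`hasEntireLFunction_of_j_mem_maximalCMJInvariants`) instead of modularity.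

## Transcription

* "`K` imaginary quadratic" = `IsImaginaryQuadratic K` (`[K : ℚ] = 2`, no real place).
* "`E` defined over `K` with complex multiplication by an order of `K`" =
  `V : WeierstrassCurve K`, `[V.IsElliptic]`, `V.HasRationalCM` ("`End_K(E) ⊋ ℤ`"). Faithfulness:
  if `E/K` has CM by an order `𝒪` of `K` then every endomorphism is defined over `K · K = K`
  (Silverman, *Advanced Topics*, II Thm. 2.2 (b)), so `End_K(E) = 𝒪 ⊋ ℤ`; conversely if
  `End_K(E) ⊋ ℤ` then `End_K(E) ⊗ ℚ` is an imaginary quadratic field `F` (II Thm. 2.2 (c) /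
  *AEC* III.9.4) acting `K`-linearly on the one-dimensional space of invariant differentials
  (II Prop. 1.1), whence an embedding `F ↪ K` and `F = K` (both quadratic): `E` has CM by the
  order `End_K(E)` of `K`. So over an imaginary quadratic `K` the two readings coincide.
* "`corank_{ℤ_p} Sel_{p^∞}(E/K)`" = `V.selmerCorank p` (`Selmer.lean`, any number field).
* "`ord_{s=1} L(s, E/K)`" = `V.analyticRank` (`AnalyticRank.lean`: the order at `s = 1` of the
  entire continuation of Mathlib's `WeierstrassCurve.LSeries V` over the number field `K`; it
  exists here by Deuring, `L(s, E/K) = L(s, ψ) L(s, ψ̄)`, arXiv p. 6 — the junk value `0` of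
  `analyticRank` for a curve WITHOUT entire `L`-function is not met by CM curves).

## What is NOT here

No proof of Thm. 1.1 (Kato's main conjecture for CM newforms in `Λ ⊗ ℚ`, Thm. 2.6, from the
Johnson-Leung–Kings equivariant main conjecture Thm. 2.1, plus Kato's explicit reciprocity law;
Thm. 3.1): the tree has no Iwasawa cohomology of newform Galois representations, no
Beilinson–Kato elements and no Bloch–Kato `H¹_f` (inventory in `BSDSelmerCMPConverse.lean`).
Theorems 2.1, 2.3, 2.4, 2.6, 3.1 and Prop. 1.3 / Thm. 3.5 (quadratic twists over `K`, density
convention of Bhargava–Klagsbrun–Lemke Oliver–Shnidman 2019, Thm. 2.7) are therefore not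
transcribed. No new definition besides the one named fact; no instance.

## References

* [BurungaleTian2026] A. A. Burungale, Y. Tian, Ann. of Math. (2) 203 (2026), no. 1, 1–13 =
  arXiv:2506.03465v2: Thm. 1.1 (p. 1) and its proof (p. 6).
* [SilvermanATAEC1994] J. H. Silverman, *Advanced Topics in the Arithmetic of Elliptic Curves*,
  GTM 151: II §1 Prop. 1.1, II §2 Thm. 2.2 (b), (c).
-/

noncomputable section

open scoped Classical

open WeierstrassCurve

namespace Literature.NumberTheory.EllipticCurves

/-- **Burungale–Tian, rank zero `p`-converse over the CM field — Theorem 1.1 as printed**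
(A. A. Burungale, Y. Tian, *A rank zero `p`-converse to a theorem of Gross–Zagier, Kolyvagin and
Rubin*, Ann. of Math. (2) 203 (2026), no. 1, 1–13 = arXiv:2506.03465v2, **Theorem 1.1**, p. 1):
"Let `E` be an elliptic curve defined over an imaginary quadratic field `K`, with complex
multiplication by an order of `K`. Let `p` be a prime. Then
`corank_{ℤ_p} Sel_{p^∞}(E/K) = 0 ⟹ ord_{s=1} L(s, E/K) = 0`."
Transcription: `K` imaginary quadratic = `IsImaginaryQuadratic K`; "defined over `K` with CM by an
order of `K`" = `V : WeierstrassCurve K` elliptic with `V.HasRationalCM` (`End_K(E) ⊋ ℤ`; over an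
imaginary quadratic `K` this is equivalent to CM by an order of `K`, Silverman *Advanced Topics*
II Prop. 1.1 and Thm. 2.2 (b), (c) — see the module docstring); corank = `V.selmerCorank p`;
`ord_{s=1} L(s, E/K)` = `V.analyticRank`. The printed last clause ("In particular, if `E` descends
to `ℚ`, then (1.1) holds") is the tree's older fact
`burungaleTian_analyticRank_eq_zero_of_selmerCorank_eq_zero_of_hasCM`, derived from this one in
`burungaleTian_analyticRank_eq_zero_of_selmerCorank_eq_zero_of_hasCM_of_hasRationalCM`.
`K : Type` (universe `0`) as in the sibling CM files. [cite: BurungaleTian2026, Thm. 1.1 (p. 1)] -/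
def burungaleTian_analyticRank_eq_zero_of_selmerCorank_eq_zero_of_hasRationalCM : Prop :=
  ∀ (K : Type) [Field K] [NumberField K], IsImaginaryQuadratic K →
    ∀ (V : WeierstrassCurve K) [V.IsElliptic], V.HasRationalCM →
      ∀ (p : ℕ) [Fact p.Prime], V.selmerCorank p = 0 → V.analyticRank = 0

/-- **Theorem 1.1 as printed implies Theorem 1.1 for the base changes `W_K` of the nine
maximal-order CM curves over `ℚ`** — the hypothesis `hBT` of
`burungaleTian_analyticRank_eq_zero_of_selmerCorank_eq_zero_of_hasCM_of_cmField`
(`BSDSelmerCMPConverseProofs`). For `W/ℚ` with `j(W) ∈ maximalCMJInvariants` and `K` its CM field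
(`IsCMFieldOfJ K j(W)`): `K` is imaginary quadratic (`[K : ℚ] = 2` by definition, no real place by
`IsCMFieldOfJ.isTotallyComplex`) and `W_K = W.baseChange K` has `K`-rational complex
multiplication (`Rubin1987.hasRationalCM_baseChange_of_isCMFieldOfJ`; Silverman, *Advanced
Topics*, II Thm. 2.2 (b): every endomorphism is defined over `ℚ K = K`).
[cite: BurungaleTian2026, Thm. 1.1 (p. 1)] -/
theorem cmField_form_of_hasRationalCM
    (h : burungaleTian_analyticRank_eq_zero_of_selmerCorank_eq_zero_of_hasRationalCM) :
    ∀ (W : WeierstrassCurve ℚ) [W.IsElliptic], W.j ∈ maximalCMJInvariants →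
      ∀ (K : Type) [Field K] [NumberField K], IsCMFieldOfJ K W.j →
        ∀ (p : ℕ) [Fact p.Prime], (W.baseChange K).selmerCorank p = 0 →
          (W.baseChange K).analyticRank = 0 := by
  intro W _ hj K _ _ hK p _ h0
  have hIQ : IsImaginaryQuadratic K := ⟨hK.1, hK.isTotallyComplex hj⟩
  exact h K hIQ (W.baseChange K) (Rubin1987.hasRationalCM_baseChange_of_isCMFieldOfJ W hj K hK) p h0

/-- **"In particular, if `E` descends to `ℚ`, then (1.1) holds"** (Burungale–Tian 2026, Thm. 1.1,
last clause; proof on arXiv p. 6): Theorem 1.1 as printed, together with modularity over `ℚ`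
(`WeierstrassCurve.hasEntireLFunction_rat`, used only to read
`ord_{s=1} L(s, E/K) = 2 · ord_{s=1} L(E, s)`, `analyticRank_baseChange_cmField`), implies the
vendored rank-zero `p`-converse for every CM elliptic curve over `ℚ` and every prime `p`
(`burungaleTian_analyticRank_eq_zero_of_selmerCorank_eq_zero_of_hasCM`): an arbitrary CM curve
over `ℚ` is `ℚ`-isogenous to one of the nine maximal-order curves, for which
`corank Sel(E/K) = 2 corank Sel(E/ℚ)` (`selmerCorank_baseChange_cmField`) — all assembled in
`burungaleTian_analyticRank_eq_zero_of_selmerCorank_eq_zero_of_hasCM_of_cmField`.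
[cite: BurungaleTian2026, Thm. 1.1 and its proof (arXiv pp. 1, 6)] -/
theorem burungaleTian_analyticRank_eq_zero_of_selmerCorank_eq_zero_of_hasCM_of_hasRationalCM
    (h : burungaleTian_analyticRank_eq_zero_of_selmerCorank_eq_zero_of_hasRationalCM)
    (hmod : hasEntireLFunction_rat) :
    burungaleTian_analyticRank_eq_zero_of_selmerCorank_eq_zero_of_hasCM :=
  burungaleTian_analyticRank_eq_zero_of_selmerCorank_eq_zero_of_hasCM_of_cmField
    (cmField_form_of_hasRationalCM h) hmod

/-- **The same descent below the Deuring–Hecke continuation** instead of modularity: Theorem 1.1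
as printed and `hasEntireLFunction_of_j_mem_maximalCMJInvariants` (`L(E, s)` entire for the nine
maximal-order CM curves, Deuring–Hecke) imply the vendored `E/ℚ` fact
(`burungaleTian_analyticRank_eq_zero_of_selmerCorank_eq_zero_of_hasCM_of_cmField_of_deuringHecke`).
[cite: BurungaleTian2026, Thm. 1.1 and its proof (arXiv pp. 1, 6)] -/
theorem burungaleTian_analyticRank_eq_zero_of_selmerCorank_eq_zero_of_hasCM_of_hasRationalCM_of_deuringHecke
    (h : burungaleTian_analyticRank_eq_zero_of_selmerCorank_eq_zero_of_hasRationalCM)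
    (hH : hasEntireLFunction_of_j_mem_maximalCMJInvariants) :
    burungaleTian_analyticRank_eq_zero_of_selmerCorank_eq_zero_of_hasCM :=
  burungaleTian_analyticRank_eq_zero_of_selmerCorank_eq_zero_of_hasCM_of_cmField_of_deuringHecke
    (cmField_form_of_hasRationalCM h) hH

end Literature.NumberTheory.EllipticCurves

end
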